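import Mathlib
import HarnessLib
import Summits.ResolutionOfSingularities.ResolutionOfSingularities.Theorems.HomologicalConductorPersistenceMFCokerDefs
import Summits.ResolutionOfSingularities.ResolutionOfSingularities.Theorems.HomologicalConductorPersistenceQuotientHypersurfacePeriodicity
import Summits.ResolutionOfSingularities.ResolutionOfSingularities.Theorems.HomologicalConductorNoZenoStableAnnihilatorReduction
import Summits.ResolutionOfSingularities.ResolutionOfSingularities.Theorems.HomologicalConductorPersistenceMatrixFactorisationExact

/-!
# The LOST ASSEMBLY LEMMA: no matrix-factorisation certificate ⇒ `x̄ ∉ caⁿ(S ⧸ (f))` for every `n`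

Route `ResolutionOfSingularities/HomologicalConductor`, chain W4.4b (crux `Persistence`
stmt-ResolutionOfSingularities-16484), CHAIN v11.1 §H2L, object **U10** (res-L1-w44b-plan-1 signature cut
`L/w44b/Sketch-U10.lean` 80484baf35faad44, 2026-08-27T09:26Z), res-D-pv-026.  [OURS · L1 w44b; AI-written,
weaker than expert review; NOT a statement of the manuscript under study, and no statement of that
manuscript is used.]

Setting: `S` noetherian, `f ∈ S` a non-zero-divisor, `φ ψ` square matrices over `S` with `φψ = f·1 = ψφ`
and `det φ ∈ S⁰` (a matrix factorisation of `f`), `T = S ⧸ (f)`, `M_φ = coker φ̄` (`MFCoker.cokerMod f φ`).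

* `finite_cokerMod` — `M_φ` is a finitely generated `T`-module;
* `exact_mulVecLin_toCoker`, `shortExact_presentation` — the length-one `S`-free resolution
  `0 → Sⁿ —φ→ Sⁿ → M_φ → 0` (`ker = φ Sⁿ + f Sⁿ = φ Sⁿ` since `f = φψ`; `φ` injective by the adjugate,
  `…MatrixFactorisationExact.mulVec_injective_of_det_mem_nonZeroDivisors`), whence
  `hasProjectiveDimensionLT_two_cokerMod` : `pd_S M_φ ≤ 1`;
* `isSyzygy_two_cokerMod` — o9f `isSyzygy_two_self_quotient` ⇒ `M_φ` is a second syzygy of itself over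
  `T`; **`isSyzygy_two_mul_cokerMod`** (U10a) — iterating with `IsSyzygy.trans`, `M_φ` is a `2j`-th syzygy
  of itself for every `j`;
* primed variants `…'` with the injectivity of `φ` (automatic from `ψφ = f·1`, `f ∈ S⁰`) instead of
  `det φ ∈ S⁰`;
* **`not_mem_cohomologyAnnihilatorOfDegree_of_no_certificate`** (U10b) — with the U7c direction of the
  stable-annihilator criterion as a hypothesis `hU7c` («`x̄` stably annihilates `M_φ` ⇒ ∃ G E,
  `x·1 = Gψ + φE`», res-D-pv-043's U7), the ABSENCE of such a certificate puts `x̄` outside `caᵐ(T)` for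
  EVERY `m`: `caᵐ ⊆ ca²ᵐ⁺¹` (monotonicity), CA1 `mem_cohomologyAnnihilatorOfDegree_succ_iff_forall_isSyzygy`
  at level `2m` with `M = K = M_φ`, U10a.

With U7 this reduces the Lean LOST side of every hypersurface certificate of the chain to the single
non-membership statement «no `G, E` with `x·1 = Gψ + φE`».
References (mechanism only): D. Eisenbud, Trans. AMS 260 (1980) §5–6; S. B. Iyengar, R. Takahashi,
IMRN 2016, §2 [`IyengarTakahashi2014`].
-/

noncomputable section

-- single-problem summit: the doubled namespace component `ResolutionOfSingularities` is forced
set_option linter.dupNamespace false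

namespace Summit.ResolutionOfSingularities.ResolutionOfSingularities.Theorems.HomologicalConductor.LostAssembly

open CategoryTheory Literature.RingTheory.CohomologyAnnihilator
open Summit.ResolutionOfSingularities.ResolutionOfSingularities.Theorems.HomologicalConductor.MFCoker
open Summit.ResolutionOfSingularities.ResolutionOfSingularities.Theorems.NoZeno.SandwichCluster
open Summit.ResolutionOfSingularities.ResolutionOfSingularities.Theorems.HomologicalConductor.QuotientHypersurfacePeriodicity
open Summit.ResolutionOfSingularities.ResolutionOfSingularities.Theorems.HomologicalConductor.MatrixFactorisationExact
open Matrix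

universe u

variable {S : Type u} [CommRing S] (f : S) {n : ℕ}

/-! ## The `T`-module `M_φ = coker φ̄` and its `S`-presentation -/

/-- `M_φ` is finitely generated over `T` (a quotient of `Tⁿ`). [OURS · L1 w44b] -/
theorem finite_cokerMod (φ : Matrix (Fin n) (Fin n) S) :
    Module.Finite (S ⧸ Ideal.span ({f} : Set S)) (cokerMod f φ) :=
  inferInstanceAs (Module.Finite (S ⧸ Ideal.span ({f} : Set S))
    ((Fin n → S ⧸ Ideal.span ({f} : Set S)) ⧸ LinearMap.range (redLin f φ)))

/-- Componentwise reduction `Sⁿ → Tⁿ` as an `S`-linear map. [OURS · L1 w44b] -/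
abbrev redVec (n : ℕ) : (Fin n → S) →ₗ[S] (Fin n → S ⧸ Ideal.span ({f} : Set S)) :=
  (Algebra.linearMap S (S ⧸ Ideal.span ({f} : Set S))).compLeft (Fin n)

/-- The `S`-linear presentation map `Sⁿ → Tⁿ → M_φ`. [OURS · L1 w44b] -/
abbrev toCoker (φ : Matrix (Fin n) (Fin n) S) : (Fin n → S) →ₗ[S] (cokerMod f φ) :=
  ((LinearMap.range (redLin f φ)).mkQ.restrictScalars S) ∘ₗ redVec f n

omit n in
/-- `redVec` is reduction modulo `f` in each component. [OURS · L1 w44b] -/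
theorem redVec_apply {n : ℕ} (v : Fin n → S) :
    redVec f n v = (Ideal.Quotient.mk (Ideal.span ({f} : Set S))) ∘ v := by
  funext i
  rfl

/-- The presentation map is surjective. [OURS · L1 w44b] -/
theorem toCoker_surjective (φ : Matrix (Fin n) (Fin n) S) : Function.Surjective (toCoker f φ) := by
  intro k
  obtain ⟨w, rfl⟩ := Submodule.Quotient.mk_surjective _ k
  have hw : ∃ v : Fin n → S, redVec f n v = w :=
    ⟨fun i => (Ideal.Quotient.mk_surjective (w i)).choose, by
      rw [redVec_apply]; funext i; exact (Ideal.Quotient.mk_surjective (w i)).choose_spec⟩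
  obtain ⟨v, hv⟩ := hw
  exact ⟨v, by simp only [LinearMap.coe_comp, Function.comp_apply, LinearMap.coe_restrictScalars, hv]; rfl⟩

/-- **Exactness of `Sⁿ —φ→ Sⁿ → M_φ`**: the kernel of the presentation map is `φ Sⁿ` (it is
`φ Sⁿ + f Sⁿ`, and `f Sⁿ = φ ψ Sⁿ ⊆ φ Sⁿ`). [OURS · L1 w44b] -/
theorem exact_mulVecLin_toCoker (φ ψ : Matrix (Fin n) (Fin n) S)
    (hφψ : φ * ψ = f • (1 : Matrix (Fin n) (Fin n) S)) :
    Function.Exact φ.mulVecLin (toCoker f φ) := by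
  intro v
  constructor
  · intro hv
    -- `red v ∈ range φ̄`: `red v = φ̄ u`, `u = red w`
    have hv' : redVec f n v ∈ LinearMap.range (redLin f φ) := by
      have : (LinearMap.range (redLin f φ)).mkQ (redVec f n v) = 0 := hv
      rwa [Submodule.mkQ_apply, Submodule.Quotient.mk_eq_zero] at this
    obtain ⟨u, hu⟩ := hv'
    have hw : ∃ w : Fin n → S, redVec f n w = u :=
      ⟨fun i => (Ideal.Quotient.mk_surjective (u i)).choose, by
        rw [redVec_apply]; funext i; exact (Ideal.Quotient.mk_surjective (u i)).choose_spec⟩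
    obtain ⟨w, rfl⟩ := hw
    rw [redVec_apply, redVec_apply, Matrix.mulVecLin_apply, map_mulVec_comp] at hu
    -- so `v - φ w ∈ f Sⁿ`, `v - φ w = f • c = φ (ψ c)`
    have hc : ∃ c : Fin n → S, v - φ *ᵥ w = f • c := by
      have hci : ∀ i, ∃ c : S, c * f = (v - φ *ᵥ w) i := fun i => by
        have hi := congrFun hu i
        simp only [Function.comp_apply] at hi
        have : (Ideal.Quotient.mk (Ideal.span ({f} : Set S))) ((v - φ *ᵥ w) i) = 0 := by
          rw [Pi.sub_apply, map_sub, hi, sub_self]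
        exact Ideal.mem_span_singleton'.mp (Ideal.Quotient.eq_zero_iff_mem.mp this)
      choose c hc using hci
      exact ⟨c, funext fun i => by rw [Pi.smul_apply, smul_eq_mul, mul_comm, hc i]⟩
    obtain ⟨c, hc⟩ := hc
    refine ⟨w + ψ *ᵥ c, ?_⟩
    rw [Matrix.mulVecLin_apply, Matrix.mulVec_add, Matrix.mulVec_mulVec, hφψ, Matrix.smul_mulVec,
      Matrix.one_mulVec, ← hc, add_sub_cancel]
  · rintro ⟨w, rfl⟩
    show (LinearMap.range (redLin f φ)).mkQ (redVec f n (φ.mulVecLin w)) = 0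
    rw [Submodule.mkQ_apply, Submodule.Quotient.mk_eq_zero]
    refine ⟨redVec f n w, ?_⟩
    rw [redVec_apply, redVec_apply, Matrix.mulVecLin_apply, Matrix.mulVecLin_apply, map_mulVec_comp]

/-- **`pd_S M_φ ≤ 1`**: from the short exact `0 → Sⁿ —φ→ Sⁿ → M_φ → 0` with `Sⁿ` projective and `φ`
injective (`det φ ∈ S⁰`). [OURS · L1 w44b] -/
theorem hasProjectiveDimensionLT_two_cokerMod (φ ψ : Matrix (Fin n) (Fin n) S)
    (hφψ : φ * ψ = f • (1 : Matrix (Fin n) (Fin n) S)) (hdet : φ.det ∈ nonZeroDivisors S) :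
    HasProjectiveDimensionLT (ModuleCat.of S (cokerMod f φ)) 2 := by
  obtain ⟨w, hSE⟩ := exists_shortExact_of_linearMap (Y := ModuleCat.of S (Fin n → S))
    (M := ModuleCat.of S (Fin n → S)) (X := ModuleCat.of S (cokerMod f φ)) φ.mulVecLin (toCoker f φ)
    (mulVec_injective_of_det_mem_nonZeroDivisors φ hdet) (toCoker_surjective f φ)
    (exact_mulVecLin_toCoker f φ ψ hφψ)
  haveI : Projective (ModuleCat.of S (Fin n → S)) :=
    (IsProjective.iff_projective (R := S) (Fin n → S)).mp inferInstance
  haveI : HasProjectiveDimensionLT (ModuleCat.of S (Fin n → S)) 2 :=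
    hasProjectiveDimensionLT_of_ge _ 1 2 (by norm_num)
  exact hSE.hasProjectiveDimensionLT_X₃ 1 inferInstance inferInstance

/-! ## U10a: `M_φ` is an even syzygy of itself -/

/-- `M_φ` is a second syzygy of itself over `T` (o9f abstract hypersurface periodicity with `pd_S M_φ ≤ 1`).
[OURS · L1 w44b] -/
theorem isSyzygy_two_cokerMod [IsNoetherianRing S] (hf : f ∈ nonZeroDivisors S) (φ ψ : Matrix (Fin n) (Fin n) S)
    (hφψ : φ * ψ = f • (1 : Matrix (Fin n) (Fin n) S)) (hdet : φ.det ∈ nonZeroDivisors S) :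
    IsSyzygy 2 (cokerMod f φ) (cokerMod f φ) := by
  haveI := finite_cokerMod f φ
  exact isSyzygy_two_self_quotient f hf (cokerMod f φ) (hasProjectiveDimensionLT_two_cokerMod f φ ψ hφψ hdet)

/-- **U10a**: `coker φ̄` is a `2j`-th syzygy of itself for every `j` (iterate the 2-periodicity with
`IsSyzygy.trans`). The hypothesis `ψ φ = f·1` of the cut is carried but not used. [OURS · L1 w44b] -/
theorem isSyzygy_two_mul_cokerMod [IsNoetherianRing S] (hf : f ∈ nonZeroDivisors S)
    (φ ψ : Matrix (Fin n) (Fin n) S) (hφψ : φ * ψ = f • (1 : Matrix (Fin n) (Fin n) S))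
    (_hψφ : ψ * φ = f • (1 : Matrix (Fin n) (Fin n) S)) (hdet : φ.det ∈ nonZeroDivisors S) (j : ℕ) :
    IsSyzygy (2 * j) (cokerMod f φ) (cokerMod f φ) := by
  induction j with
  | zero => exact ⟨Iso.refl _⟩
  | succ j ih =>
    have h2 := isSyzygy_two_cokerMod f hf φ ψ hφψ hdet
    have h := IsSyzygy.trans ih h2
    have e : 2 * (j + 1) = 2 + 2 * j := by ring
    rw [e]
    exact h

/-! ## U10b: the lost assembly lemma -/

/-- **U10b — the LOST ASSEMBLY LEMMA.** `S` noetherian, `f ∈ S⁰`, `φψ = f·1 = ψφ`, `det φ ∈ S⁰`, `x ∈ S`.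
Assume the U7c direction of the matrix-factorisation stable-annihilator criterion for this data
(`hU7c`: if `x̄` stably annihilates `coker φ̄` then `x·1 = Gψ + φE` for some `G E`). If NO such certificate
exists, then `x̄ ∉ caᵐ(S ⧸ (f))` for EVERY `m`: otherwise `x̄ ∈ caᵐ ⊆ ca²ᵐ⁺¹`, and CA1 at level `2m` applied
to the `2m`-th self-syzygy `coker φ̄` (U10a) makes `x̄` stably annihilate it. [OURS · L1 w44b] -/
theorem not_mem_cohomologyAnnihilatorOfDegree_of_no_certificate [IsNoetherianRing S] (hf : f ∈ nonZeroDivisors S)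
    (φ ψ : Matrix (Fin n) (Fin n) S) (hφψ : φ * ψ = f • (1 : Matrix (Fin n) (Fin n) S))
    (hψφ : ψ * φ = f • (1 : Matrix (Fin n) (Fin n) S)) (hdet : φ.det ∈ nonZeroDivisors S) (x : S)
    (hU7c : StablyAnnihilates (S ⧸ Ideal.span ({f} : Set S)) (Ideal.Quotient.mk _ x) (cokerMod f φ) →
      ∃ G E : Matrix (Fin n) (Fin n) S, x • (1 : Matrix (Fin n) (Fin n) S) = G * ψ + φ * E)
    (hcert : ¬ ∃ G E : Matrix (Fin n) (Fin n) S, x • (1 : Matrix (Fin n) (Fin n) S) = G * ψ + φ * E)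
    (m : ℕ) :
    Ideal.Quotient.mk (Ideal.span ({f} : Set S)) x ∉
      cohomologyAnnihilatorOfDegree (S ⧸ Ideal.span ({f} : Set S)) m := by
  intro hx
  have hx' : Ideal.Quotient.mk (Ideal.span ({f} : Set S)) x ∈
      cohomologyAnnihilatorOfDegree (S ⧸ Ideal.span ({f} : Set S)) (2 * m + 1) :=
    cohomologyAnnihilatorOfDegree_mono (show m ≤ 2 * m + 1 by omega) hx
  have hK := (mem_cohomologyAnnihilatorOfDegree_succ_iff_forall_isSyzygy
    (T := S ⧸ Ideal.span ({f} : Set S)) (n := 2 * m) _).mp hx' (cokerMod f φ) (cokerMod f φ)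
    (finite_cokerMod f φ) (isSyzygy_two_mul_cokerMod f hf φ ψ hφψ hψφ hdet m)
  exact hcert (hU7c hK)

/-! ## Variants with the injectivity of `φ` as the hypothesis (no determinant) -/

/-- `pd_S M_φ ≤ 1` from the INJECTIVITY of `φ` on `Sⁿ` (e.g. from `ψφ = f·1`, `f ∈ S⁰`, by
`MatrixFactorisationExact.mulVec_injective_of_mul_eq_smul_one` — no determinant needed). [OURS · L1 w44b] -/
theorem hasProjectiveDimensionLT_two_cokerMod' (φ ψ : Matrix (Fin n) (Fin n) S)
    (hφψ : φ * ψ = f • (1 : Matrix (Fin n) (Fin n) S)) (hφ : Function.Injective φ.mulVec) :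
    HasProjectiveDimensionLT (ModuleCat.of S (cokerMod f φ)) 2 := by
  obtain ⟨w, hSE⟩ := exists_shortExact_of_linearMap (Y := ModuleCat.of S (Fin n → S))
    (M := ModuleCat.of S (Fin n → S)) (X := ModuleCat.of S (cokerMod f φ)) φ.mulVecLin (toCoker f φ)
    hφ (toCoker_surjective f φ) (exact_mulVecLin_toCoker f φ ψ hφψ)
  haveI : Projective (ModuleCat.of S (Fin n → S)) :=
    (IsProjective.iff_projective (R := S) (Fin n → S)).mp inferInstance
  haveI : HasProjectiveDimensionLT (ModuleCat.of S (Fin n → S)) 2 :=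
    hasProjectiveDimensionLT_of_ge _ 1 2 (by norm_num)
  exact hSE.hasProjectiveDimensionLT_X₃ 1 inferInstance inferInstance

/-- `M_φ` is a `2j`-th syzygy of itself, injectivity form: `φψ = f·1 = ψφ`, `f ∈ S⁰` suffice
(`φ` is then injective). [OURS · L1 w44b] -/
theorem isSyzygy_two_mul_cokerMod' [IsNoetherianRing S] (hf : f ∈ nonZeroDivisors S)
    (φ ψ : Matrix (Fin n) (Fin n) S) (hφψ : φ * ψ = f • (1 : Matrix (Fin n) (Fin n) S))
    (hψφ : ψ * φ = f • (1 : Matrix (Fin n) (Fin n) S)) (j : ℕ) :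
    IsSyzygy (2 * j) (cokerMod f φ) (cokerMod f φ) := by
  have hφ : Function.Injective φ.mulVec := mulVec_injective_of_mul_eq_smul_one f ψ φ hψφ hf
  haveI := finite_cokerMod f φ
  have h2 : IsSyzygy 2 (cokerMod f φ) (cokerMod f φ) :=
    isSyzygy_two_self_quotient f hf (cokerMod f φ) (hasProjectiveDimensionLT_two_cokerMod' f φ ψ hφψ hφ)
  induction j with
  | zero => exact ⟨Iso.refl _⟩
  | succ j ih =>
    have h := IsSyzygy.trans ih h2
    have e : 2 * (j + 1) = 2 + 2 * j := by ring
    rw [e]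
    exact h

/-- **U10b, injectivity form** (no `det φ` hypothesis): `S` noetherian, `f ∈ S⁰`, `φψ = f·1 = ψφ`,
`hU7c`, no certificate ⇒ `x̄ ∉ caᵐ(S ⧸ (f))` for every `m`. [OURS · L1 w44b] -/
theorem not_mem_cohomologyAnnihilatorOfDegree_of_no_certificate' [IsNoetherianRing S]
    (hf : f ∈ nonZeroDivisors S) (φ ψ : Matrix (Fin n) (Fin n) S)
    (hφψ : φ * ψ = f • (1 : Matrix (Fin n) (Fin n) S)) (hψφ : ψ * φ = f • (1 : Matrix (Fin n) (Fin n) S))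
    (x : S)
    (hU7c : StablyAnnihilates (S ⧸ Ideal.span ({f} : Set S)) (Ideal.Quotient.mk _ x) (cokerMod f φ) →
      ∃ G E : Matrix (Fin n) (Fin n) S, x • (1 : Matrix (Fin n) (Fin n) S) = G * ψ + φ * E)
    (hcert : ¬ ∃ G E : Matrix (Fin n) (Fin n) S, x • (1 : Matrix (Fin n) (Fin n) S) = G * ψ + φ * E)
    (m : ℕ) :
    Ideal.Quotient.mk (Ideal.span ({f} : Set S)) x ∉
      cohomologyAnnihilatorOfDegree (S ⧸ Ideal.span ({f} : Set S)) m := by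
  intro hx
  have hx' : Ideal.Quotient.mk (Ideal.span ({f} : Set S)) x ∈
      cohomologyAnnihilatorOfDegree (S ⧸ Ideal.span ({f} : Set S)) (2 * m + 1) :=
    cohomologyAnnihilatorOfDegree_mono (show m ≤ 2 * m + 1 by omega) hx
  have hK := (mem_cohomologyAnnihilatorOfDegree_succ_iff_forall_isSyzygy
    (T := S ⧸ Ideal.span ({f} : Set S)) (n := 2 * m) _).mp hx' (cokerMod f φ) (cokerMod f φ)
    (finite_cokerMod f φ) (isSyzygy_two_mul_cokerMod' f hf φ ψ hφψ hψφ m)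
  exact hcert (hU7c hK)

end Summit.ResolutionOfSingularities.ResolutionOfSingularities.Theorems.HomologicalConductor.LostAssembly

end
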